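import Summits.QuantumFields.YangMills.Theorems.BalabanUVNodesN16H7OfReg9
import HarnessLib

/-!
# Route «BalabanUVNodes» (K3⁷ `SpineGivenEndpointR13SepCoPH`, stmt-QuantumFields-20544), DAG node N16 = NE3 — THE N07 → N16 EDGE `h7`:
# FRONTS.  The kinematic FRONT CRITERION against the linear sup-leaf `LeafH3sup … ε (C·ε) (C·ε)` (covariant telescoping along straight
# segments, BY NAME), the EXACT negation shape of `stub_h7` it yields, and the abstract NEAR-SATURATION ⇒ FRONT-MASS inequality along one line

Cell `pub-ymgap`, width seat `pub-ymgap-dag-n16-w1` (director-ym №197 ∕ HUMAN RULING D-0149), generation 3, file 5 — over this lineage's files 1–4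
(`BalabanUVNodesN16H7OfReg9` p584527, `…TightWindow` p586490, `…OfN07RecordSlot` p588364, `…NoBinding` p593465) and their LOCATED notes (evidence
#9∕#14∕#24 on stmt-QuantumFields-20544).  `--kind proof --supports stmt-QuantumFields-20544 --as helper` (count-neutral).  `bears_on: R4∕N16 · edge N07 → N16`.

THE POINT.  dag-n16-e's `stub_h7` (evidence #6 `N16DischargeTest.lean`) asks, for all small `ε`, ALL data `V ∈ ne3DomOfRecord₁₁ F N 0 0` (= all
`2L^m`-periodic `SU(N)` configurations) and all levels `k+1`, that every minimiser `U` of the Wilson action over the plaquette ball `sfClass 4 L Nper ε (k+1)`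
with `(k+1)`-fold average `V` be `RegularSup … (C·ε) (C·ε) (k+1)`: in particular `‖(∇_U F)(b; π)‖ ≤ C·ε·η³`, `η = L^{−(k+1)}` — a factor `η` better than the
trivial `2·ε·η²`.  Files 1–4 showed: on LOOSE data (`V ∈ sfClass (ε∕B₃) 0`) this is [Balaban1985Variational] Theorem 1 (8)–(10) read at leaf-06's torus
instances; on the TIGHT window `]ε∕B₃, 4ε]` it is an OBSTACLE-REGULARITY statement print never makes (AP-N16-2), equivalently Theorem 1 ∧ NO-BINDING, and
NO-BINDING fails on an open set of data in the linearised abelian model (g2).  THIS FILE supplies the kernel half of the next step — the located finding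
(HOME `LOCATED-N16-H7-FRONTS.md`, evidence on 20544) that AP-N16-2 itself FAILS in that model by FRONT FORMATION: for in-plane alternating block data at
relative slack `δ` below the feasibility edge the box-constrained minimiser is `±ε·η²`-saturated off transition layers of width `≈ M·δ` fine steps
(`M = L^{k+1}`; transition width `≈ M·√(3δ)` mid-cell, where the dual zigzag vanishes), with lattice gradient `|∇F| ≈ (2∕√(3δ))·ε·η³` there (exact
rationals: `M·max|∇F|∕(εη²) = 9.14` at `δ = 1∕64` for `M = 32, 64`); so for EVERY `C` the linear leaf fails at data with `δ < 4∕(3C²)`, uniformly in `k`.  What the kernel can say about this, at the tree's objects and BY NAME, is: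
 * §1 COVARIANT TELESCOPING ALONG A STRAIGHT SEGMENT (`AveragingDeficitNearIdentity.norm_Ad_hol_sub_le_sum_covGrad` BY NAME, specialised to `seg κ r`):
   `‖Ad_{U(x → x + r e_κ)} F(x + r e_κ; π) − F(x; π)‖ ≤ r·B` whenever the covariant gradients along the segment are `≤ B`; under
   `RegularSup d L N b c j U` the bound is `r · c∕(Lʲ)³` (`norm_Ad_holSeg_flux_sub_le_of_regularSup`).
 * §2 THE FRONT CRITERION: a configuration exhibiting two plaquettes `(x; π)`, `(x + r e_κ; π)` whose transported fluxes differ by MORE than `r·c∕(Lʲ)³`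
   (a «front of ratio `> c`») is NOT `RegularSup … c j` (`not_regularSup_of_front`); a minimiser at a datum `V ∈ dom` with such a front kills the leaf
   `LeafH3sup d L N ε b c dom` (`not_leafH3sup_of_front`); and the EXACT negation shape of `stub_h7`: if for every `C ≥ 0` and `ε₀ > 0` some minimiser over
   `sfClass ε`, `0 < ε ≤ ε₀`, at some datum of `dom` carries a front of ratio `> C·ε`, then `¬ ∃ C ε₀, 0 ≤ C ∧ 0 < ε₀ ∧ ∀ ε ∈ ]0,ε₀], LeafH3sup … ε (C·ε) (C·ε) dom`
   (`not_h7Shape_of_fronts`; at the record's letters `not_h7_at_record_of_fronts`).  A front is DETECTED from near-saturation: `norm_Ad_sub_ge_of_near`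
   (`‖Ad_u Y − X‖ ≥ ‖Ad_u B − A‖ − ‖X − A‖ − ‖Y − B‖`).
 * §3 THE ABSTRACT NEAR-SATURATION ⇒ FRONT-MASS INEQUALITY along one line (real analysis in a seminormed group; the convex∕combinatorial heart of the refutation
   road, model-free): for a `λ`-Lipschitz sequence `F : ℕ → E` and targets `A` (indices `< M`) ∕ `B` (indices `≥ M`), the saturation deficits of the pair
   `(M−1−t, M+t)` sum to `≥ ‖A − B‖ − λ(2t+1)` (`front_pair_deficit`); if the pairs `t ≤ t₀` each have deficit sum `≥ D` and weights `≥ φ₀(t+1)∕M`, the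
   weighted deficit mass of the window is `≥ φ₀·D·(t₀+1)²∕(2M)` (`front_mass_lower_bound`); against a budget `≤ δ·S` this forces
   `φ₀·D·(t₀+1)² ≤ 2·M·δ·S` (`slack_lower_bound_of_front`).  With `λ = C·ε·η³`, `‖A − B‖ = 2εη²`, `t₀ ≈ M∕(2C)`, `S ≈ φ̄·εη²·M` this reads `δ ≳ φ₀∕(16 φ̄ C²)`:
   Φ-weighted `δ`-near-saturation with `δ = K·ε` (the duality pairing of the datum against the alternating pattern, [Balaban1985Averaging] Prop. 2-type
   linearisation with remainder — NOT in this file) is incompatible with the linear leaf once `ε < φ₀∕(16 φ̄ K C²)` and `M > C`.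
 * §5 (v1.1) THE ℓ²-FORM ALONG A LINE: `norm_Ad_holSeg_sub_le_sum_range` (telescoping as a `range` sum), `sq_front_le_mul_sum_sq_covGrad` (Cauchy–Schwarz:
   `h² ≤ r·Σ_{j<r}‖∇_V F‖²`), `sq_front_le_of_sum_sq_covGrad_le` — what a front costs an ℓ²-leaf (`LeafH3`, THE END's actual input) on its own line.
 * §4 THE LINE FRONT THEOREM AT THE TREE'S OBJECTS (§3 instantiated through §1): under `RegularSup d L N b c j U` the fluxes transported back along a
   forward `κ`-line, `F̃ i = Ad_{U(x → x + i e_κ)} F(x + i e_κ; π)`, form a `c∕(Lʲ)³`-Lipschitz sequence (`norm_transportedFlux_succ_sub_le`), so for targets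
   `A`, `B` separated by `c∕(Lʲ)³·(2t₀+1) + D ≤ ‖A − B‖` and weights `≥ φ₀(t+1)∕M` the Φ-weighted deficit mass across the block boundary is
   `≥ φ₀·D·(t₀+1)²∕(2M)` (`front_mass_of_regularSup_line`) — the quantitative form in which the linear leaf resists near-saturation at opposite targets.

HONEST FRAMING.  Kinematic bookkeeping over landed theorems BY NAME (§1, §2, §4) and an abstract inequality (§3); 0 `def`, 0 sorry.  NOTHING of Bałaban is
asserted or refuted; `stub_h7` is NOT closed and NOT refuted in the kernel (the near-saturation input (a) of the road is open: the linearisation-with-remainder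
of the ITERATED average (42)); the model computation behind the located note is heuristic for the tree's non-abelian objects and says so; N16 ∕ N07 ∕ NE3
NOT discharged; count-neutral; counts of record unmoved (typed 28∕28 · discharged 5∕27); one finite four-torus at fixed `ε`, Bałaban AS PRINTED — NOT ℝ⁴, NOT
infinite volume, NOT OS, NOT a mass gap; the YM mass gap (Clay) is NOT proved by any of this — R4 closes the conditional finite-𝕋⁴ rung `BalabanLadder.UV` only.
-/

set_option autoImplicit false

open scoped BigOperators Matrix Matrix.Norms.L2Operator
open NormedSpace Finset

namespace Summit.QuantumFields.YangMills.BalabanUVNodes.N16H7Fronts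

open Literature.MathematicalPhysics.QuantumFieldTheory.Balaban1983to89
open B7Prop1Explicit B7Prop2Explicit MatrixLog UnitaryModel
open T4AveragingDeficitWall hiding Site Plane Plaq Bond
open T4AveragingDeficitNonAbelian (Ad_mul Ad_sub)
open T4Continuum (T4Family)
open Summit.QuantumFields.BalabanUV.T4Continuum
open AveragingDeficitLocality (bondsOf bondsOf_nil bondsOf_cons)
open AveragingDeficitTransport (norm_Ad_of_unitary)
open AveragingDeficitTransportCalc (mem_bondsOf_seg_iff)
open AveragingDeficitNearIdentity (norm_Ad_hol_sub_le_sum_covGrad)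
open MinimalActionSandwich (IsMinimiser)
open MinimalActionRate (sfClass)
open MinimalActionRefine (RegularSup)
open NE3.LeafIndexSockets (LeafH3sup)
open Node00 (ne3NperOfRecord₁₁ ne3DomOfRecord₁₁ MatA)

noncomputable section

variable {d : ℕ} {n : Type*} [Fintype n] [DecidableEq n]

/-! ## §1 Covariant telescoping along a straight segment -/

omit [Fintype n] [DecidableEq n] in
/-- A word of length `m` traverses `m` bonds. [folklore] -/
theorem length_bondsOf : ∀ (x : Site d) (w : List (Letter d)), (bondsOf x w).length = w.length
  | _, [] => rfl
  | x, l :: w => by rw [bondsOf_cons, List.length_cons, List.length_cons, length_bondsOf (x + l.vec) w]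

/-- A list sum of terms each `≤ B` is `≤ length · B`. [folklore] -/
theorem sum_map_le_length_mul {α : Type*} (l : List α) (f : α → ℝ) {B : ℝ} (h : ∀ a ∈ l, f a ≤ B) :
    (l.map f).sum ≤ (l.length : ℝ) * B := by
  induction l with
  | nil => simp
  | cons a l ih =>
    rw [List.map_cons, List.sum_cons, List.length_cons, Nat.cast_succ, add_mul, one_mul, add_comm ((l.length : ℝ) * B)]
    exact add_le_add (h a (by simp)) (ih fun b hb => h b (by simp [hb]))

/-- **COVARIANT TELESCOPING ALONG A STRAIGHT SEGMENT**: for a unitary configuration `V`, any plaquette function `F`, a plane `π` and the forward segment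
of `r` steps in direction `κ` from `x`, if every covariant gradient `‖(∇_V F)(x + j e_κ, κ; π)‖`, `j < r`, is `≤ B`, then
`‖Ad_{V(x → x + r e_κ)} F(x + r e_κ; π) − F(x; π)‖ ≤ r · B` (`AveragingDeficitNearIdentity.norm_Ad_hol_sub_le_sum_covGrad` BY NAME at the word `seg κ r`). [folklore] -/
theorem norm_Ad_holSeg_sub_le_of_covGrad_le {V : Site d → Fin d → (Matrix n n ℂ)ˣ} (hV : IsUnitaryCfg V)
    (F : T4AveragingDeficitWall.Plaq d → Matrix n n ℂ) (π : T4AveragingDeficitWall.Plane d) (x : Site d) (κ : Fin d) (r : ℕ)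
    {B : ℝ} (hB : ∀ j : ℕ, j < r → ‖covGrad V F (x + (j : ℤ) • e κ) κ π‖ ≤ B) :
    ‖Ad (hol V x (seg κ (r : ℤ))) (F (x + (r : ℤ) • e κ, π)) - F (x, π)‖ ≤ (r : ℝ) * B := by
  have h := norm_Ad_hol_sub_le_sum_covGrad hV F π x (seg κ (r : ℤ))
  rw [disp_seg] at h
  refine h.trans ?_
  have hlen : ((bondsOf x (seg κ (r : ℤ))).length : ℝ) = r := by
    rw [length_bondsOf, length_seg, Int.natAbs_natCast]
  rw [← hlen]
  refine sum_map_le_length_mul _ _ fun b hb => ?_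
  obtain ⟨j, hj, rfl⟩ := (mem_bondsOf_seg_iff x κ r b).mp hb
  exact hB j hj

/-- **UNDER `RegularSup` THE TRANSPORTED FLUX VARIES BY AT MOST `r · c∕(Lʲ)³` OVER `r` STRAIGHT STEPS**: the (10)-TYPE pointwise bound
`‖(∇_U F)(b; π)‖ ≤ c∕(Lʲ)³` of `MinimalActionRefine.RegularSup d L N b c j U`, telescoped. [folklore] -/
theorem norm_Ad_holSeg_flux_sub_le_of_regularSup {L N j : ℕ} {b c : ℝ} {U : Site d → Fin d → (Matrix n n ℂ)ˣ}
    (hU : RegularSup d L N b c j U) (x : Site d) (κ : Fin d) (π : T4AveragingDeficitWall.Plane d) (r : ℕ) :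
    ‖Ad (hol U x (seg κ (r : ℤ))) (flux U (x + (r : ℤ) • e κ, π)) - flux U (x, π)‖ ≤ (r : ℝ) * (c / ((L : ℝ) ^ j) ^ 3) :=
  norm_Ad_holSeg_sub_le_of_covGrad_le hU.unitary (flux U) π x κ r fun _ _ => hU.grad _ κ π

/-! ## §2 The front criterion and the exact negation shape of `stub_h7` -/

/-- **A FRONT KILLS `RegularSup`**: if two plaquettes `(x; π)` and `(x + r e_κ; π)` of `U` have transported fluxes differing by MORE than `r · c∕(Lʲ)³`, then
`U` is not `RegularSup d L N b c j` (contrapositive of §1). [folklore] -/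
theorem not_regularSup_of_front {L N j : ℕ} {b c : ℝ} {U : Site d → Fin d → (Matrix n n ℂ)ˣ}
    {x : Site d} {κ : Fin d} {π : T4AveragingDeficitWall.Plane d} {r : ℕ}
    (hfront : (r : ℝ) * (c / ((L : ℝ) ^ j) ^ 3) < ‖Ad (hol U x (seg κ (r : ℤ))) (flux U (x + (r : ℤ) • e κ, π)) - flux U (x, π)‖) :
    ¬ RegularSup d L N b c j U := fun hU =>
  absurd (norm_Ad_holSeg_flux_sub_le_of_regularSup hU x κ π r) (not_le.mpr hfront)

/-- **A MINIMISER WITH A FRONT KILLS THE LEAF**: if some minimiser `U` of run `k+1` over `sfClass d L N ε` at a datum `V ∈ dom` carries a front of ratio `> c`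
(two plaquettes `r` straight steps apart whose transported fluxes differ by more than `r · c∕(L^{k+1})³`), then `¬ LeafH3sup d L N ε b c dom`. [folklore] -/
theorem not_leafH3sup_of_front {L N : ℕ} {ε b c : ℝ} {dom : Set (Site d → Fin d → (Matrix n n ℂ)ˣ)}
    {V : Site d → Fin d → (Matrix n n ℂ)ˣ} (hV : V ∈ dom) {k : ℕ} {U : Site d → Fin d → (Matrix n n ℂ)ˣ}
    (hU : IsMinimiser d (sfClass d L N ε) L N (k + 1) V U)
    {x : Site d} {κ : Fin d} {π : T4AveragingDeficitWall.Plane d} {r : ℕ}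
    (hfront : (r : ℝ) * (c / ((L : ℝ) ^ (k + 1)) ^ 3) < ‖Ad (hol U x (seg κ (r : ℤ))) (flux U (x + (r : ℤ) • e κ, π)) - flux U (x, π)‖) :
    ¬ LeafH3sup d L N ε b c dom := fun h =>
  not_regularSup_of_front hfront (h V hV k U hU)

/-- **★ THE EXACT NEGATION SHAPE OF `stub_h7`** (any `d`, `L`, `N`, `dom`): if for EVERY `C ≥ 0` and `ε₀ > 0` there are a radius `0 < ε ≤ ε₀`, a datum `V ∈ dom`,
a level `k+1` and a minimiser `U` over `sfClass d L N ε` at `(V, k+1)` carrying a front of ratio `> C·ε` — two plaquettes `r` straight steps apart whose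
transported fluxes differ by more than `r · C·ε∕(L^{k+1})³` — then the linear sup-leaf family `∃ C ε₀, 0 ≤ C ∧ 0 < ε₀ ∧ ∀ ε ∈ ]0,ε₀], LeafH3sup d L N ε (C·ε) (C·ε) dom`
is FALSE.  (The located note's model exhibits such fronts at in-plane alternating data with relative slack `δ < 4∕(3C²)` below the feasibility edge; at the
tree's objects the road is §3–§4 plus a near-saturation input — NOT supplied here.) [folklore] -/
theorem not_h7Shape_of_fronts {L N : ℕ} {dom : Set (Site d → Fin d → (Matrix n n ℂ)ˣ)}
    (hfronts : ∀ C ε₀ : ℝ, 0 ≤ C → 0 < ε₀ → ∃ ε : ℝ, 0 < ε ∧ ε ≤ ε₀ ∧ ∃ V ∈ dom, ∃ (k : ℕ) (U : Site d → Fin d → (Matrix n n ℂ)ˣ),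
      IsMinimiser d (sfClass d L N ε) L N (k + 1) V U ∧ ∃ (x : Site d) (κ : Fin d) (π : T4AveragingDeficitWall.Plane d) (r : ℕ),
        (r : ℝ) * (C * ε / ((L : ℝ) ^ (k + 1)) ^ 3) < ‖Ad (hol U x (seg κ (r : ℤ))) (flux U (x + (r : ℤ) • e κ, π)) - flux U (x, π)‖) :
    ¬ ∃ C ε₀ : ℝ, 0 ≤ C ∧ 0 < ε₀ ∧ ∀ ε : ℝ, 0 < ε → ε ≤ ε₀ → LeafH3sup d L N ε (C * ε) (C * ε) dom := by
  rintro ⟨C, ε₀, hC, hε₀, h⟩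
  obtain ⟨ε, hε, hεε₀, V, hV, k, U, hU, x, κ, π, r, hfront⟩ := hfronts C ε₀ hC hε₀
  exact not_leafH3sup_of_front hV hU hfront (h ε hε hεε₀)

/-- **THE NEGATION SHAPE OF `stub_h7` AT THE RECORD'S LETTERS** (d = 4, `L = F.L`, period `ne3NperOfRecord₁₁ F 0 0`, data `ne3DomOfRecord₁₁ F N 0 0` — dag-n16-e's
evidence #6 `N16DischargeTest.stub_h7 F`): fronts of every ratio at minimisers over the record's plaquette balls refute it.  Nothing is asserted about whether
such fronts exist (the located note argues they do, for `N ≥ 2`). [folklore] -/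
theorem not_h7_at_record_of_fronts {N : ℕ} (F : T4Family)
    (hfronts : ∀ C ε₀ : ℝ, 0 ≤ C → 0 < ε₀ → ∃ ε : ℝ, 0 < ε ∧ ε ≤ ε₀ ∧ ∃ V ∈ ne3DomOfRecord₁₁ F N 0 0,
      ∃ (k : ℕ) (U : Site 4 → Fin 4 → (MatA N)ˣ),
        IsMinimiser 4 (sfClass 4 F.L (ne3NperOfRecord₁₁ F 0 0) ε) F.L (ne3NperOfRecord₁₁ F 0 0) (k + 1) V U ∧
        ∃ (x : Site 4) (κ : Fin 4) (π : T4AveragingDeficitWall.Plane 4) (r : ℕ),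
          (r : ℝ) * (C * ε / ((F.L : ℝ) ^ (k + 1)) ^ 3) < ‖Ad (hol U x (seg κ (r : ℤ))) (flux U (x + (r : ℤ) • e κ, π)) - flux U (x, π)‖) :
    ¬ ∃ C ε₀ : ℝ, 0 ≤ C ∧ 0 < ε₀ ∧ ∀ ε : ℝ, 0 < ε → ε ≤ ε₀ →
      LeafH3sup 4 F.L (ne3NperOfRecord₁₁ F 0 0) ε (C * ε) (C * ε) (ne3DomOfRecord₁₁ F N 0 0) :=
  not_h7Shape_of_fronts hfronts

/-- **FRONT DETECTION FROM NEAR-SATURATION**: for unitary `u` and matrices `X, Y` within `g, g′` of targets `A, B`,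
`‖Ad_u B − A‖ − g − g′ ≤ ‖Ad_u Y − X‖` — a pair of plaquettes whose (transported) fluxes are near OPPOSITE targets is a front of height `≈ ‖Ad_u B − A‖`. [folklore] -/
theorem norm_Ad_sub_ge_of_near {u : (Matrix n n ℂ)ˣ} (hu : u ∈ unitaryUnits (Matrix n n ℂ)) {X Y A B : Matrix n n ℂ} {g g' : ℝ}
    (hX : ‖X - A‖ ≤ g) (hY : ‖Y - B‖ ≤ g') : ‖Ad u B - A‖ - g - g' ≤ ‖Ad u Y - X‖ := by
  have e1 : Ad u B - A = (Ad u Y - X) - Ad u (Y - B) + (X - A) := by rw [Ad_sub]; abel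
  have h1 : ‖Ad u B - A‖ ≤ ‖Ad u Y - X‖ + ‖Ad u (Y - B)‖ + ‖X - A‖ := by
    rw [e1]; exact (norm_add_le _ _).trans (add_le_add (norm_sub_le _ _) le_rfl)
  rw [norm_Ad_of_unitary hu] at h1
  linarith

/-! ## §3 The abstract near-saturation ⇒ front-mass inequality along one line -/

/-- Telescoping a `λ`-Lipschitz sequence: `‖F j − F i‖ ≤ λ·(j − i)` for `i ≤ j`. [folklore] -/
theorem norm_sub_le_of_lipschitz_seq {E : Type*} [SeminormedAddCommGroup E] {F : ℕ → E} {lam : ℝ}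
    (hlip : ∀ i, ‖F (i + 1) - F i‖ ≤ lam) {i j : ℕ} (hij : i ≤ j) : ‖F j - F i‖ ≤ lam * ((j : ℝ) - i) := by
  obtain ⟨m, rfl⟩ := Nat.exists_eq_add_of_le hij
  induction m with
  | zero => simp
  | succ m ih =>
    have h1 : F (i + (m + 1)) - F i = (F (i + m + 1) - F (i + m)) + (F (i + m) - F i) := by
      rw [← add_assoc]; abel
    rw [h1]
    refine (norm_add_le _ _).trans ?_
    have h2 := hlip (i + m)
    have h3 := ih (Nat.le_add_right i m)
    push_cast at h3 ⊢
    linarith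

/-- **THE PAIR DEFICIT ACROSS A FRONT**: for a `λ`-Lipschitz sequence `F` and targets `A`, `B`, the saturation deficits of the indices `i ≤ j` satisfy
`‖A − B‖ − λ(j − i) ≤ ‖F i − A‖ + ‖F j − B‖` — two values `λ(j−i)`-close cannot both be near far-apart targets. [folklore] -/
theorem front_pair_deficit {E : Type*} [SeminormedAddCommGroup E] {F : ℕ → E} {lam : ℝ}
    (hlip : ∀ i, ‖F (i + 1) - F i‖ ≤ lam) (A B : E) {i j : ℕ} (hij : i ≤ j) :
    ‖A - B‖ - lam * ((j : ℝ) - i) ≤ ‖F i - A‖ + ‖F j - B‖ := by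
  have h1 : A - B = (F j - B) - (F j - F i) - (F i - A) := by abel
  have h2 : ‖A - B‖ ≤ ‖F j - B‖ + ‖F j - F i‖ + ‖F i - A‖ := by
    rw [h1]; exact (norm_sub_le _ _).trans (add_le_add (norm_sub_le _ _) le_rfl)
  have h3 := norm_sub_le_of_lipschitz_seq hlip hij
  linarith

/-- **★ THE FRONT-MASS LOWER BOUND.**  Indices `M−1−t` (left of the front) and `M+t` (right of it), `t ≤ t₀ < M`; non-negative deficits `g` with pair sums
`g(M−1−t) + g(M+t) ≥ D` (from `front_pair_deficit` while `λ(2t+1) ≤ ‖A−B‖ − D`); non-negative weights with `φ(M−1−t), φ(M+t) ≥ φ₀(t+1)∕M` (a duality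
pattern vanishing linearly at the block boundary, as the in-plane TENT weights of (42) do).  THEN the weighted deficit mass of the window is at least
`φ₀ · D · (t₀+1)² ∕ (2M)`. [folklore] -/
theorem front_mass_lower_bound {M t₀ : ℕ} (ht₀ : t₀ + 1 ≤ M) {g φ : ℕ → ℝ} {D φ₀ : ℝ} (hD : 0 ≤ D) (hφ₀ : 0 ≤ φ₀)
    (hg : ∀ i, 0 ≤ g i) (hpair : ∀ t, t ≤ t₀ → D ≤ g (M - 1 - t) + g (M + t))
    (hφl : ∀ t, t ≤ t₀ → φ₀ * (t + 1) / M ≤ φ (M - 1 - t)) (hφr : ∀ t, t ≤ t₀ → φ₀ * (t + 1) / M ≤ φ (M + t)) :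
    φ₀ * D * ((t₀ : ℝ) + 1) ^ 2 / (2 * M) ≤ ∑ t ∈ range (t₀ + 1), (φ (M - 1 - t) * g (M - 1 - t) + φ (M + t) * g (M + t)) := by
  have hM : (0 : ℝ) < M := by exact_mod_cast (by omega : 0 < M)
  -- each pair contributes at least `φ₀ (t+1)/M · D`
  have hterm : ∀ t ∈ range (t₀ + 1), φ₀ * D / M * ((t : ℝ) + 1) ≤ φ (M - 1 - t) * g (M - 1 - t) + φ (M + t) * g (M + t) := by
    intro t ht
    have ht' : t ≤ t₀ := by rw [mem_range] at ht; omega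
    have h1 := hφl t ht'
    have h2 := hφr t ht'
    have h3 := hpair t ht'
    have hw : 0 ≤ φ₀ * (t + 1) / M := by positivity
    calc φ₀ * D / M * ((t : ℝ) + 1) = φ₀ * (t + 1) / M * D := by ring
      _ ≤ φ₀ * (t + 1) / M * (g (M - 1 - t) + g (M + t)) := mul_le_mul_of_nonneg_left h3 hw
      _ = φ₀ * (t + 1) / M * g (M - 1 - t) + φ₀ * (t + 1) / M * g (M + t) := by ring
      _ ≤ φ (M - 1 - t) * g (M - 1 - t) + φ (M + t) * g (M + t) :=
          add_le_add (mul_le_mul_of_nonneg_right h1 (hg _)) (mul_le_mul_of_nonneg_right h2 (hg _))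
  refine le_trans ?_ (sum_le_sum hterm)
  rw [← mul_sum]
  -- `Σ_{t ≤ t₀} (t+1) = (t₀+1)(t₀+2)/2 ≥ (t₀+1)²/2`
  have hsum : ∀ m : ℕ, ∑ t ∈ range (m + 1), ((t : ℝ) + 1) = ((m : ℝ) + 1) * ((m : ℝ) + 2) / 2 := by
    intro m
    induction m with
    | zero => norm_num
    | succ m ih => rw [sum_range_succ, ih]; push_cast; ring
  rw [hsum t₀]
  have hpos : 0 ≤ φ₀ * D / M := by positivity
  have ht0 : (0 : ℝ) ≤ t₀ := Nat.cast_nonneg _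
  have hineq : ((t₀ : ℝ) + 1) ^ 2 / 2 ≤ ((t₀ : ℝ) + 1) * ((t₀ : ℝ) + 2) / 2 := by nlinarith
  calc φ₀ * D * ((t₀ : ℝ) + 1) ^ 2 / (2 * M) = φ₀ * D / M * (((t₀ : ℝ) + 1) ^ 2 / 2) := by field_simp
    _ ≤ φ₀ * D / M * (((t₀ : ℝ) + 1) * ((t₀ : ℝ) + 2) / 2) := mul_le_mul_of_nonneg_left hineq hpos

/-- **THE SLACK LOWER BOUND A FRONT FORCES**: under the hypotheses of `front_mass_lower_bound`, if the weighted deficit mass of the window is within a budget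
`δ · S` (Φ-weighted `δ`-near-saturation of total weight `S`), then `φ₀ · D · (t₀+1)² ≤ 2 · M · δ · S`.  (Read with `D = εη²`, `t₀ + 1 ≥ M∕(2C)`, `S ≤ φ̄·εη²·M`:
`δ ≥ φ₀∕(8 φ̄ C²)`.) [folklore] -/
theorem slack_lower_bound_of_front {M t₀ : ℕ} (ht₀ : t₀ + 1 ≤ M) {g φ : ℕ → ℝ} {D φ₀ δ S : ℝ} (hD : 0 ≤ D) (hφ₀ : 0 ≤ φ₀)
    (hg : ∀ i, 0 ≤ g i) (hpair : ∀ t, t ≤ t₀ → D ≤ g (M - 1 - t) + g (M + t))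
    (hφl : ∀ t, t ≤ t₀ → φ₀ * (t + 1) / M ≤ φ (M - 1 - t)) (hφr : ∀ t, t ≤ t₀ → φ₀ * (t + 1) / M ≤ φ (M + t))
    (hbudget : ∑ t ∈ range (t₀ + 1), (φ (M - 1 - t) * g (M - 1 - t) + φ (M + t) * g (M + t)) ≤ δ * S) :
    φ₀ * D * ((t₀ : ℝ) + 1) ^ 2 ≤ 2 * M * (δ * S) := by
  have hM : (0 : ℝ) < M := by exact_mod_cast (by omega : 0 < M)
  have h := (front_mass_lower_bound ht₀ hD hφ₀ hg hpair hφl hφr).trans hbudget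
  rw [div_le_iff₀ (by positivity)] at h
  calc φ₀ * D * ((t₀ : ℝ) + 1) ^ 2 ≤ δ * S * (2 * M) := h
    _ = 2 * M * (δ * S) := by ring

/-! ## §4 The line front theorem at the tree's objects: a `RegularSup` configuration pays deficit mass across a block boundary -/

/-- **THE TRANSPORTED FLUX SEQUENCE ALONG A LINE IS `c∕(Lʲ)³`-LIPSCHITZ UNDER `RegularSup`**: with `F̃ i := Ad_{U(x → x + i e_κ)} F(x + i e_κ; π)` (fluxes
transported back to the frame at `x` along the straight segment), `‖F̃(i+1) − F̃ i‖ = ‖(∇_U F)(x + i e_κ, κ; π)‖ ≤ c∕(Lʲ)³` (`hol_seg_natCast_succ`, `Ad_mul`,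
unitary invariance of the operator norm). [folklore] -/
theorem norm_transportedFlux_succ_sub_le {L N j : ℕ} {b c : ℝ} {U : Site d → Fin d → (Matrix n n ℂ)ˣ}
    (hU : RegularSup d L N b c j U) (x : Site d) (κ : Fin d) (π : T4AveragingDeficitWall.Plane d) (i : ℕ) :
    ‖Ad (hol U x (seg κ ((i + 1 : ℕ) : ℤ))) (flux U (x + ((i + 1 : ℕ) : ℤ) • e κ, π))
        - Ad (hol U x (seg κ (i : ℤ))) (flux U (x + (i : ℤ) • e κ, π))‖ ≤ c / ((L : ℝ) ^ j) ^ 3 := by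
  have hstep : hol U x (seg κ ((i + 1 : ℕ) : ℤ)) = hol U x (seg κ (i : ℤ)) * U (x + (i : ℤ) • e κ) κ := by
    rw [Nat.cast_succ]; exact hol_seg_natCast_succ U x κ i
  have e1 : x + ((i + 1 : ℕ) : ℤ) • e κ = x + (i : ℤ) • e κ + e κ := by
    rw [Nat.cast_succ, add_smul, one_smul, add_assoc]
  rw [hstep, Ad_mul, e1, ← Ad_sub, norm_Ad_of_unitary (hol_mem_of hU.unitary _ _)]
  exact hU.grad (x + (i : ℤ) • e κ) κ π

/-- **★ THE LINE FRONT THEOREM (the tree-object form of §3).**  Let `U` be `RegularSup d L N b c j`, fix a forward `κ`-line from `x` in the plane `π` and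
let `F̃ i = Ad_{U(x → x + i e_κ)} F(x + i e_κ; π)` be the transported fluxes.  Let `A`, `B` be target matrices («`+εη²H`» left of a block boundary at index
`M`, «`−εη²H`» right of it), `D ≥ 0`, `t₀ + 1 ≤ M` with the SEPARATION `c∕(Lʲ)³ · (2t₀+1) + D ≤ ‖A − B‖`, and weights `φ(M−1−t), φ(M+t) ≥ φ₀(t+1)∕M` for
`t ≤ t₀`.  THEN the Φ-weighted deficit mass of the window is at least `φ₀ · D · (t₀+1)²∕(2M)`:
`Σ_{t ≤ t₀} (φ(M−1−t)·‖F̃(M−1−t) − A‖ + φ(M+t)·‖F̃(M+t) − B‖) ≥ φ₀ D (t₀+1)²∕(2M)`.  Read with `c = C·ε`, `j = k+1`, `M = L^{k+1}` (so `c∕(Lʲ)³ = Cε η³`),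
`‖A − B‖ = 2εη²`, `D = εη²`, `2t₀ + 1 ≈ M∕C`: a regular configuration Φ-near-saturated at opposite targets across an in-plane block boundary pays deficit
mass `≳ φ₀ εη² M∕(8C²)` per line per front — against a near-saturation budget `δ·φ̄·εη²·M` this forces `δ ≳ φ₀∕(8 φ̄ C²)`.  Nothing of Bałaban asserted;
whether minimisers at tight data ARE near-saturated is the open input (a) of the located note's road. [folklore] -/
theorem front_mass_of_regularSup_line {L N j : ℕ} {b c : ℝ} {U : Site d → Fin d → (Matrix n n ℂ)ˣ}
    (hU : RegularSup d L N b c j U) (x : Site d) (κ : Fin d) (π : T4AveragingDeficitWall.Plane d)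
    {Ft : ℕ → Matrix n n ℂ} (hFt : ∀ i : ℕ, Ft i = Ad (hol U x (seg κ (i : ℤ))) (flux U (x + (i : ℤ) • e κ, π)))
    (A B : Matrix n n ℂ) {M t₀ : ℕ} (ht₀ : t₀ + 1 ≤ M) {D φ₀ : ℝ} (hD : 0 ≤ D) (hφ₀ : 0 ≤ φ₀)
    (hsep : c / ((L : ℝ) ^ j) ^ 3 * (2 * t₀ + 1) + D ≤ ‖A - B‖)
    {φ : ℕ → ℝ} (hφl : ∀ t, t ≤ t₀ → φ₀ * (t + 1) / M ≤ φ (M - 1 - t)) (hφr : ∀ t, t ≤ t₀ → φ₀ * (t + 1) / M ≤ φ (M + t)) :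
    φ₀ * D * ((t₀ : ℝ) + 1) ^ 2 / (2 * M)
      ≤ ∑ t ∈ range (t₀ + 1), (φ (M - 1 - t) * ‖Ft (M - 1 - t) - A‖ + φ (M + t) * ‖Ft (M + t) - B‖) := by
  have hlam0 : 0 ≤ c / ((L : ℝ) ^ j) ^ 3 := (norm_nonneg _).trans (hU.grad x κ π)
  have hlip : ∀ i, ‖Ft (i + 1) - Ft i‖ ≤ c / ((L : ℝ) ^ j) ^ 3 := fun i => by
    rw [hFt, hFt]; exact norm_transportedFlux_succ_sub_le hU x κ π i
  -- the deficits against the two targets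
  set g : ℕ → ℝ := fun i => if i < M then ‖Ft i - A‖ else ‖Ft i - B‖ with hgdef
  have hg : ∀ i, 0 ≤ g i := fun i => by
    simp only [hgdef]; split_ifs <;> exact norm_nonneg _
  have hgl : ∀ t, t ≤ t₀ → g (M - 1 - t) = ‖Ft (M - 1 - t) - A‖ := fun t ht => by
    simp only [hgdef]; rw [if_pos (by omega)]
  have hgr : ∀ t, g (M + t) = ‖Ft (M + t) - B‖ := fun t => by
    simp only [hgdef]; rw [if_neg (by omega)]
  have hpair : ∀ t, t ≤ t₀ → D ≤ g (M - 1 - t) + g (M + t) := by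
    intro t ht
    rw [hgl t ht, hgr t]
    have h := front_pair_deficit hlip A B (show M - 1 - t ≤ M + t by omega)
    have h1 : (M - 1 - t : ℕ) + (t + 1) = M := by omega
    have hcast : ((M - 1 - t : ℕ) : ℝ) = (M : ℝ) - t - 1 := by
      have h2 := congrArg (Nat.cast (R := ℝ)) h1
      push_cast at h2
      linarith
    have hdiff : ((M + t : ℕ) : ℝ) - ((M - 1 - t : ℕ) : ℝ) = 2 * t + 1 := by rw [hcast]; push_cast; ring
    rw [hdiff] at h
    have ht' : (t : ℝ) ≤ t₀ := by exact_mod_cast ht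
    have hmono : c / ((L : ℝ) ^ j) ^ 3 * (2 * t + 1) ≤ c / ((L : ℝ) ^ j) ^ 3 * (2 * t₀ + 1) :=
      mul_le_mul_of_nonneg_left (by linarith) hlam0
    linarith
  have hmass := front_mass_lower_bound ht₀ hD hφ₀ hg hpair hφl hφr
  refine hmass.trans (le_of_eq (sum_congr rfl fun t ht => ?_))
  have ht' : t ≤ t₀ := by rw [mem_range] at ht; omega
  rw [hgl t ht', hgr t]

/-! ## §5 (v1.1) The ℓ²-form of the front criterion along a line (Cauchy–Schwarz) -/

/-- Covariant telescoping along the forward segment as a `Finset.range` sum (induction on `r` over `hol_seg_natCast_succ`, `Ad_mul`, unitary invariance):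
`‖Ad_{V(x → x + r e_κ)} F(x + r e_κ; π) − F(x; π)‖ ≤ Σ_{j<r} ‖(∇_V F)(x + j e_κ, κ; π)‖`. [folklore] -/
theorem norm_Ad_holSeg_sub_le_sum_range {V : Site d → Fin d → (Matrix n n ℂ)ˣ} (hV : IsUnitaryCfg V)
    (F : T4AveragingDeficitWall.Plaq d → Matrix n n ℂ) (π : T4AveragingDeficitWall.Plane d) (x : Site d) (κ : Fin d) :
    ∀ r : ℕ, ‖Ad (hol V x (seg κ (r : ℤ))) (F (x + (r : ℤ) • e κ, π)) - F (x, π)‖ ≤ ∑ j ∈ range r, ‖covGrad V F (x + (j : ℤ) • e κ) κ π‖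
  | 0 => by simp [AveragingDeficitNearIdentity.Ad_one]
  | r + 1 => by
    have ih := norm_Ad_holSeg_sub_le_sum_range hV F π x κ r
    have hstep : hol V x (seg κ ((r + 1 : ℕ) : ℤ)) = hol V x (seg κ (r : ℤ)) * V (x + (r : ℤ) • e κ) κ := by
      rw [Nat.cast_succ]; exact hol_seg_natCast_succ V x κ r
    have e1 : x + ((r + 1 : ℕ) : ℤ) • e κ = x + (r : ℤ) • e κ + e κ := by
      rw [Nat.cast_succ, add_smul, one_smul, add_assoc]
    have e2 : Ad (hol V x (seg κ (r : ℤ)) * V (x + (r : ℤ) • e κ) κ) (F (x + (r : ℤ) • e κ + e κ, π)) - F (x, π)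
        = Ad (hol V x (seg κ (r : ℤ))) (covGrad V F (x + (r : ℤ) • e κ) κ π)
          + (Ad (hol V x (seg κ (r : ℤ))) (F (x + (r : ℤ) • e κ, π)) - F (x, π)) := by
      rw [covGrad, Ad_sub, Ad_mul]; abel
    rw [hstep, e1, e2, sum_range_succ]
    refine (norm_add_le _ _).trans ?_
    rw [norm_Ad_of_unitary (hol_mem_of hV _ _), add_comm]
    exact add_le_add ih le_rfl

/-- **THE ℓ²-FORM OF THE FRONT CRITERION** (Cauchy–Schwarz on §5's sum, `sq_sum_le_card_mul_sum_sq`): a front of height `h = ‖Ad_{V(seg)} F(x + r e_κ; π) − F(x; π)‖` across `r`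
straight steps forces `h² ≤ r · Σ_{j<r} ‖(∇_V F)(x + j e_κ, κ; π)‖²` — the ℓ²-gradient mass a front costs on its own line.  Read against an ℓ²-leaf (`MinimalActionRate.Regular`'s
gradient budget `∝ c²η⁶` per site, what THE END consumes via `leafH3_of_leafH3sup`): fronts of height `≈ 2εη²` and width `w` cost `≈ 4ε²η⁴∕w` per line, sharp ones (`w = 1`) an
`η⁴ = M^{−4}` amount per line against a per-line budget `c²η⁶·M ∝ M^{−5}` — the located note's «ℓ²-leaf fails too» in kernel letters, line by line. [folklore] -/
theorem sq_front_le_mul_sum_sq_covGrad {V : Site d → Fin d → (Matrix n n ℂ)ˣ} (hV : IsUnitaryCfg V)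
    (F : T4AveragingDeficitWall.Plaq d → Matrix n n ℂ) (π : T4AveragingDeficitWall.Plane d) (x : Site d) (κ : Fin d) (r : ℕ) :
    ‖Ad (hol V x (seg κ (r : ℤ))) (F (x + (r : ℤ) • e κ, π)) - F (x, π)‖ ^ 2 ≤ (r : ℝ) * ∑ j ∈ range r, ‖covGrad V F (x + (j : ℤ) • e κ) κ π‖ ^ 2 := by
  have h := norm_Ad_holSeg_sub_le_sum_range hV F π x κ r
  have hcs := sq_sum_le_card_mul_sum_sq (s := range r) (f := fun j => ‖covGrad V F (x + (j : ℤ) • e κ) κ π‖)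
  rw [card_range] at hcs
  exact (pow_le_pow_left₀ (norm_nonneg _) h 2).trans hcs

/-- **AN ℓ²-BUDGET ALONG THE LINE BOUNDS EVERY FRONT**: if `Σ_{j<r} ‖(∇_V F)(x + j e_κ, κ; π)‖² ≤ Q` then the front height satisfies `h² ≤ r·Q` — contrapositively a front
with `h² > r·Q` kills any leaf whose ℓ²-gradient budget on that segment is `Q`. [folklore] -/
theorem sq_front_le_of_sum_sq_covGrad_le {V : Site d → Fin d → (Matrix n n ℂ)ˣ} (hV : IsUnitaryCfg V)
    (F : T4AveragingDeficitWall.Plaq d → Matrix n n ℂ) (π : T4AveragingDeficitWall.Plane d) (x : Site d) (κ : Fin d) (r : ℕ) {Q : ℝ}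
    (hQ : ∑ j ∈ range r, ‖covGrad V F (x + (j : ℤ) • e κ) κ π‖ ^ 2 ≤ Q) :
    ‖Ad (hol V x (seg κ (r : ℤ))) (F (x + (r : ℤ) • e κ, π)) - F (x, π)‖ ^ 2 ≤ (r : ℝ) * Q :=
  (sq_front_le_mul_sum_sq_covGrad hV F π x κ r).trans (mul_le_mul_of_nonneg_left hQ (Nat.cast_nonneg r))

end

end Summit.QuantumFields.YangMills.BalabanUVNodes.N16H7Fronts
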